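import Literature.AlgebraicGeometry.Morphisms.ZariskiConnectednessLimit
import Literature.AlgebraicGeometry.Morphisms.StageImagesProper
import Literature.AlgebraicGeometry.Morphisms.SteinFactorizationLocalCriterion
import Literature.AlgebraicGeometry.Morphisms.SteinFactorizationProofs
import Literature.AlgebraicGeometry.Limits.FiniteTypeModel
import HarnessLib

/-!
# Stein factorisation has geometrically connected fibres (The Stacks Project, Tag 03H2 (1)): discharge

Topic: `Literature/AlgebraicGeometry/Morphisms`. This file proves the named fact
`Literature.AlgebraicGeometry.Morphisms.steinFactorization_geometricallyConnected` of
`Literature/AlgebraicGeometry/Morphisms/SteinFactorization.lean`: **for every proper morphism of schemes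
`f : X → S`, the morphism `f' : X → S'` to the normalisation `S'` of `S` in `X` (the Stein
factorisation `f = π ∘ f'`) has geometrically connected fibres**
(`steinFactorization_geometricallyConnected_holds`), and with it the named fact
`geometricallyConnected_towards_normal` (The Stacks Project, Tag 0AY8), which
`SteinFactorizationProofs.geometricallyConnected_towards_normal_of_steinFactorization` had reduced to it
(`geometricallyConnected_towards_normal_holds`).

The proof follows The Stacks Project (Tags 03GY, 03H2, 0G7X, 0A0Q/09ZR), assembled from the tree:

1. *Reduction to a local connectedness statement* (`SteinFactorizationLocalCriterion`,
   `steinFactorization_geometricallyConnected_of_localConn`: Tag 03H2 from Tag 0G7X; the étale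
   localisation of the printed proof replaced by finite free local base change): it suffices that for
   every local ring `B` and every proper `g : Y → Spec B` with `B ≅ Γ(Y, 𝒪_Y)` the closed fibre
   `Y ×_B κ_B` is preconnected.
2. *The Noetherian case* (`ZariskiConnectednessProper`: EGA III₁ 4.3.1, the theorem on formal functions
   through Mittag-Leffler and the finiteness theorem Tag 02O5) and *its transfer to one Noetherian
   proper model dominating the closed fibre* (`SteinFactorizationNoetherianModel`, Tag 0G7X, general case:
   idempotents on the closed fibre lift along a closed `B`-immersion `Y ↪ Y' ×_{B₀} B` onto on closed
   fibres, `Y'` proper over a Noetherian `B₀`).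
3. *Existence of such a model for every proper `Y → Spec B`* (Tags 0A0Q/09ZR for `S = Spec B`), in
   three steps: (a) `Limits/FiniteTypeModel*`: `Y ↪ M ×_{A₀} Spec B` closed with `M` separated of
   finite type over a finitely generated subring `A₀ ⊆ B` (Tag 09ZP, by gluing the spectra of finitely
   generated subrings of the rings of sections of a finite affine cover); (b)
   `ZariskiConnectednessLimit` (`exists_stage`, `isPullback_model`, `surjective_modelLift_map`): over the
   stages `K[t] ⊆ B` of `M ×_{A₀} Spec B = lim_t M ×_{A₀} Spec K[t]` a finite type sub-ideal-sheaf of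
   `𝓘_Y` with the same closed fibre descends (Görtz–Wedhorn I, Prop. 10.75), so that the
   scheme-theoretic image `Y'_t` of `Y` pulls back to a closed subscheme `Y⁺ ⊇ Y` of `M ×_{A₀} Spec B`
   with the closed fibre of `Y`; (c) `StageImagesProper` (`exists_forall_isProper_stageImage`, the
   properness step of Tag 09ZR through Chow's lemma Tag 02O2 and Tag 01Z3): `Y'_t` is proper over `K[t]`
   for `t` large. `preconnectedSpace_closedFibre_of_isProper` assembles (a), (b), (c) and 2.

Everything is proved; no named facts are introduced (two named facts discharged).

## References

* The Stacks Project, Tag 03H2 (More on Morphisms, Theorem 37.53.5 (1)), Tags 03GY, 0G7X, 0A0Q, 09ZR,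
  09ZP, 02O2, 02O5, 01Z3. [StacksProject]
* A. Grothendieck, J. Dieudonné, EGA III₁ (1961), Thm. 4.1.5, Thm. 4.3.1, Cor. 4.3.4; EGA IV₃ (1966),
  Thm. 8.8.2, Thm. 8.10.5.
* U. Görtz, T. Wedhorn, *Algebraic Geometry I*, 2nd ed. (2020), (10.13), Thm. 10.57, Prop. 10.75,
  Thm. 12.68, Thm. 13.100. [GortzWedhorn2020]
-/

noncomputable section

universe u

open CategoryTheory CategoryTheory.Limits AlgebraicGeometry TopologicalSpace Opposite MonoidalCategory
open Literature.AlgebraicGeometry.Limits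
open Literature.AlgebraicGeometry.Motives (SchemeOver specOver)

namespace Literature.AlgebraicGeometry.Morphisms

namespace NoetherianModel

open IsLocalRing Scheme.IdealSheafData

set_option backward.isDefEq.respectTransparency false

/-- **The local connectedness core of Tag 03H2 (1) for every proper `g : Y → Spec B`** (`B` local,
`B ≅ Γ(Y, 𝒪_Y)`): the closed fibre `Y ×_B κ_B` is preconnected. By `Limits.exists_finiteTypeModel`
(Tag 09ZP for `S = Spec B`) `Y` is a closed subscheme of `M ×_{A₀} Spec B` with `M` separated of finite
type over a finitely generated (Noetherian) subring `A₀ ⊆ B`. A stage `A₀[t] ⊆ B` of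
`M ×_{A₀} Spec B = lim_t M ×_{A₀} Spec A₀[t]` is chosen so that the scheme-theoretic image `Y'_t` of `Y`
in `M ×_{A₀} Spec A₀[t]` has a base change `Y⁺ ⊇ Y` with the closed fibre of `Y` (a finite type
`𝓙 ⊆ 𝓘_Y` with the same pull-back to the closed fibre, `exists_fg_le_comap_eq`, descended by
`Limits.exists_comap_map_eq` = Görtz–Wedhorn I, Prop. 10.75; `surjective_modelLift_map`) AND is proper
over `A₀[t]` (`StageImages.exists_forall_isProper_stageImage`); then
`preconnectedSpace_closedFibre_of_noetherianModel` (Tag 0G7X, general case) applies. This is the input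
`hConn` of `steinFactorization_geometricallyConnected_of_localConn`.
[cite: StacksProject, Tag 0G7X (Derived Categories of Schemes, Lemma lemma-proper-idempotent-on-fibre, general case) and Tag 0A0Q (Limits of Schemes, Lemma lemma-proper-limit-of-proper-finite-presentation-noetherian)] -/
theorem preconnectedSpace_closedFibre_of_isProper (B : Type u) [CommRing B] [IsLocalRing B]
    ⦃Y : Scheme.{u}⦄ (g : Y ⟶ Spec (.of B)) [IsProper g] (hiso : IsIso g.appTop) :
    PreconnectedSpace ↥(pullback g (Spec.map (CommRingCat.ofHom (residue B)))) := by
  classical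
  -- ### a finite type model `Y ↪ M ×_{A₀} Spec B`
  obtain ⟨A₀, _, φ, M₀, p, j, hNoeth, -, -, hsep, hlft, hqc, hj, hjg⟩ := exists_finiteTypeModel g
  letI : Algebra A₀ B := φ.toAlgebra
  haveI := hNoeth
  haveI := hiso
  let P : SchemeOver A₀ := Over.mk p
  haveI : IsSeparated P.hom := hsep
  haveI : QuasiCompact P.hom := hqc
  haveI : LocallyOfFiniteType P.hom := hlft
  let jY : Y ⟶ (P ⊗ specOver A₀ B).left := j
  haveI : IsClosedImmersion jY := hj
  have hg : jY ≫ pullback.snd P.hom (specOver A₀ B).hom = g := hjg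
  haveI : IsProper (jY ≫ pullback.snd P.hom (specOver A₀ B).hom) := by rw [hg]; infer_instance
  -- ### a stage from which on the models have the closed fibre of `Y` (as in `exists_stage`)
  have hstage : ∃ i : (SubalgApprox.Idx B (∅ : Finset B))ᵒᵖ, ∀ (j : (SubalgApprox.Idx B (∅ : Finset B))ᵒᵖ) (_ : j ⟶ i),
      ∃ J : ((P ⊗ specOver A₀ B).left).IdealSheafData, J ≤ jY.ker ∧
        J.comap (pullback.fst (pullback.snd P.hom (specOver A₀ B).hom) (Spec.map (CommRingCat.ofHom (residue B)))) =
          jY.ker.comap (pullback.fst (pullback.snd P.hom (specOver A₀ B).hom) (Spec.map (CommRingCat.ofHom (residue B)))) ∧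
        (J.map ((SubalgApprox.prodCone A₀ B ∅ P).π.app j)).comap ((SubalgApprox.prodCone A₀ B ∅ P).π.app j) = J := by
    haveI : CompactSpace ↥(specOver A₀ B).left := inferInstanceAs (CompactSpace ↥(Spec (.of B)))
    haveI : QuasiSeparatedSpace ↥(specOver A₀ B).left := inferInstanceAs (QuasiSeparatedSpace ↥(Spec (.of B)))
    haveI : CompactSpace ↥(P ⊗ specOver A₀ B).left := SubalgApprox.compactSpace_tensorObj_left P
    haveI : QuasiSeparatedSpace ↥(P ⊗ specOver A₀ B).left := SubalgApprox.quasiSeparatedSpace_tensorObj_left P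
    let pB : (P ⊗ specOver A₀ B).left ⟶ Spec (.of B) := pullback.snd P.hom (specOver A₀ B).hom
    let q := Spec.map (CommRingCat.ofHom (residue B))
    haveI : CompactSpace ↥(pullback pB q) := QuasiCompact.compactSpace_of_compactSpace (pullback.snd pB q)
    haveI : IsLocallyNoetherian (pullback pB q) := LocallyOfFiniteType.isLocallyNoetherian (pullback.snd pB q)
    obtain ⟨J, hJfg, hJI, hJcomap⟩ := exists_fg_le_comap_eq (pullback.fst pB q) jY.ker
    obtain ⟨i, hi⟩ := Limits.exists_comap_map_eq (SubalgApprox.prodDiagram A₀ B ∅ P)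
      (SubalgApprox.prodCone A₀ B ∅ P) (SubalgApprox.isLimitProdCone A₀ B ∅ P) J hJfg
    exact ⟨i, fun j φ => ⟨J, hJI, hJcomap, hi j φ⟩⟩
  -- ### a stage from which on the stage images are proper; a common one
  obtain ⟨i, hi⟩ := hstage
  obtain ⟨i₁, hi₁⟩ := StageImages.exists_forall_isProper_stageImage P jY
  obtain ⟨k, ⟨φ₀⟩, ⟨φ₁⟩⟩ := SubalgApprox.exists_hom₂ B (∅ : Finset B) i i₁
  haveI := isNoetherianRing_sub (K := A₀) (B := B) k
  haveI := isClosedImmersion_modelLift P jY k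
  haveI : IsProper ((jY ≫ (SubalgApprox.prodCone A₀ B ∅ P).π.app k).ker.subschemeι ≫
      pullback.snd P.hom (specOver A₀ ↥(SubalgApprox.sub A₀ B k.unop.1)).hom) := hi₁ k φ₁
  -- ### the Noetherian proper model dominating the closed fibre
  exact preconnectedSpace_closedFibre_of_noetherianModel (SubalgApprox.sub A₀ B k.unop.1).val.toRingHom
    _ _ _ (isPullback_model P jY k) g _ (modelLift_comp P jY g hg k)
    (surjective_modelLift_map P jY g hg k (hi k φ₀))

end NoetherianModel

/-! ## The named fact -/

/-- **The Stacks Project, Tag 03H2 (1): the Stein factorisation `f' : X → S'` of a proper morphism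
`f : X → S` has geometrically connected fibres** — discharge of the named fact
`steinFactorization_geometricallyConnected` (for every proper `f` over every scheme `S`), by
`steinFactorization_geometricallyConnected_of_localConn` (Tag 03H2 from the local connectedness core)
and `NoetherianModel.preconnectedSpace_closedFibre_of_isProper` (the core, Tag 0G7X with the Noetherian
approximation Tag 0A0Q). [cite: StacksProject, Tag 03H2 (More on Morphisms, Theorem 37.53.5 (1))] -/
theorem steinFactorization_geometricallyConnected_holds : steinFactorization_geometricallyConnected.{u} :=
  steinFactorization_geometricallyConnected_of_localConn
    fun B _ _ _ g _ hiso => NoetherianModel.preconnectedSpace_closedFibre_of_isProper B g hiso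

/-- **The Stacks Project, Tag 0AY8 (proper morphisms towards a normal base have `f_* 𝒪_X = 𝒪_S` and
geometrically connected fibres)** — discharge of the named fact `geometricallyConnected_towards_normal`,
which `geometricallyConnected_towards_normal_of_steinFactorization`
(`Literature/AlgebraicGeometry/Morphisms/SteinFactorizationProofs.lean`, the printed proof of Tag 0AY8)
reduces to Tag 03H2 (1), now `steinFactorization_geometricallyConnected_holds`.
[cite: StacksProject, Tag 0AY8 (More on Morphisms, Lemma 37.53.6)] -/
theorem geometricallyConnected_towards_normal_holds : geometricallyConnected_towards_normal.{u} :=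
  geometricallyConnected_towards_normal_of_steinFactorization steinFactorization_geometricallyConnected_holds

end Literature.AlgebraicGeometry.Morphisms

end
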